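import Summits.CriticalPhenomena.PercolationContinuityZ3.Theorems.Transplant.KNCells2ThetaPosChosenO
import Summits.CriticalPhenomena.PercolationContinuityZ3.Theorems.Transplant.KNCells2ThetaPosChosen
import Summits.CriticalPhenomena.PercolationContinuityZ3.Theorems.Transplant.KNCellsSchemeO
import Summits.CriticalPhenomena.PercolationContinuityZ3.Theorems.Transplant.KNCellsProcessO
import Summits.CriticalPhenomena.PercolationContinuityZ3.Theorems.Transplant.KNCellsRunO
import Summits.CriticalPhenomena.PercolationContinuityZ3.Theorems.Transplant.KNCellsRunInvO
import Summits.CriticalPhenomena.PercolationContinuityZ3.Theorems.Transplant.KNCells2SchemeO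
import Summits.CriticalPhenomena.PercolationContinuityZ3.Theorems.Transplant.KNCells2RunO
import Summits.CriticalPhenomena.PercolationContinuityZ3.Theorems.Transplant.KNCells2RunInvO
import Summits.CriticalPhenomena.PercolationContinuityZ3.Theorems.Transplant.KNCellsCoverO
import Summits.CriticalPhenomena.PercolationContinuityZ3.Theorems.Transplant.KNCells2CoverO
import Summits.CriticalPhenomena.PercolationContinuityZ3.Theorems.Transplant.KNCellsReachO
import Summits.CriticalPhenomena.PercolationContinuityZ3.Theorems.Transplant.KNCells2ReachO
import Summits.CriticalPhenomena.PercolationContinuityZ3.Theorems.Transplant.KNCellsExitO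
import Summits.CriticalPhenomena.PercolationContinuityZ3.Theorems.Transplant.KNCells2ExitO
import Summits.CriticalPhenomena.PercolationContinuityZ3.Theorems.Transplant.KNCellsStepsDefsO
import Summits.CriticalPhenomena.PercolationContinuityZ3.Theorems.Transplant.KNCellsStepsChainO
import Summits.CriticalPhenomena.PercolationContinuityZ3.Theorems.Transplant.KNCellsStepsFailO
import Summits.CriticalPhenomena.PercolationContinuityZ3.Theorems.Transplant.KNCells2StepsO
import Summits.CriticalPhenomena.PercolationContinuityZ3.Theorems.Transplant.KNCells2FailO
import Summits.CriticalPhenomena.PercolationContinuityZ3.Theorems.Transplant.KNCells2FacePrefixO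
import Summits.CriticalPhenomena.PercolationContinuityZ3.Theorems.Transplant.KNCells2KitAtChosen
import Literature.Probability.Percolation.OrientedHistorySiteRenormalizationRun
import Summits.CriticalPhenomena.PercolationContinuityZ3.Theorems.Transplant.KNCells2RunRestricted
import Summits.CriticalPhenomena.PercolationContinuityZ3.Theorems.Transplant.KNCells2KitAtRun
import HarnessLib

/-!
# N2 (frames-only node `SamePDropOfSkeletonFrm₁`, OPEN) — ORIENTED MACRO LAYER (WAVE 0 (c1), (R-18) `q ≡ true`): the oriented twin of N1's `KNCells2KitAtChosen`

builds on p205010 (kernel theorem, internal audit signed; external expert review pending) — nothing in this file uses p205010; NOTHING is claimed about the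
open node `SamePDropOfSkeletonFrm₁` (`SamePDropOfSkeletonNeg₁` is CLOSED in the tree and untouched by this file).
Status sentence (coordinator 2026-08-20T04:30Z): "θ(p_c) = 0 on ℤ^d, all d ≥ 2 — kernel-verified (Lean 4/Mathlib, standard axioms); internal adversarial
audit SIGNED 2026-08-20 04:29Z; external expert review pending."
Lane `prim-bschramm-*`, seat `prim-bschramm-stmt` (gen 19); helper file (`--supports stmt-CriticalPhenomena-4575 --as helper`); N2-SCOPE §20, (R-18)/(R-19).
PORT RULES (HOME/prim-bschramm-stmt-g19/lean/port_orient.py): the history-site API is replaced by its ORIENTED twin at the fixed quadrant `qNE := fun _ => true`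
(`HState.choice ↦ HState.ochoice qNE`, `mstOf ↦ omstOf qNE`, `mst/stN ↦ omst/ostN qNE`, `occFinal ↦ ooccFinal qNE`, `Lawful ↦ OLawful qNE`, onward directions
`onward ↦ onwardO` = the POSITIVE ones, (N2-e)); every declaration whose text changes thereby — directly or through a changed declaration — is re-declared with the
suffix `O` (same namespace); unchanged declarations of the N1 file are NOT repeated (the N1 module is imported). Docstrings/citations are N1's.
N1 HEADER (kept for the reader):
[cite: KozmaNitzan2024, §4 Theorem 6 (pp. 25–31), (30), (32)]
-/
noncomputable section

open MeasureTheory ProbabilityTheory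
open scoped ENNReal Classical

namespace Summit.CriticalPhenomena.PercolationContinuityZ3.Theorems

namespace Transplant

namespace KNCells

open Literature.Probability.Percolation Literature.Probability.LatticeModels SimpleGraph GadgetSystem ProbeHistory HSiteScheme Contour

namespace KSchA

variable {V : Type} [DecidableEq V] [Countable V]
variable {A : Type*} {G : SimpleGraph V} [G.LocallyFinite] {S : KSchA V A} {FD : FaceData V A} {LD : LevelData V A}

/-- **The probabilistic obligations of the node AT CHOSEN EDGES** (stmt's `KitAt` with `(S.astOf₂O G h).st.ochoice qNE = some e` added to the
face and corridor clauses; the root clause is unchanged). [cite: KozmaNitzan2024, §4 (30), (32), Lemma 10 at the faces, Lemmas 11–12] -/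
def KitAtChosenO (G : SimpleGraph V) [G.LocallyFinite] (S : KSchA V A) (FD : FaceData V A) (δ₂ ε' : ℝ) : Prop :=
  (∀ du : MDir, du.2 = qNE du.1 → 1 - S.δc < (prodBernoulli (pinW (KNLevels.lattW G S.p) ↑(S.U₀ G) ↑(S.U₀ G))).real
      (⋃ t ∈ (↑(S.Γ.M S.Γ.a₀ ((0 : Site 2) + stepVec du)) : Set V),
        openConnIn (↑(S.Γ.Q S.Γ.a₀ 0 ∪ S.Γ.Ewv S.Γ.a₀ 0 du) : Set V) S.Γ.root t)) ∧
  (∀ h e, (S.astOf₂O G h).st.ochoice qNE = some e → S.Valid₂O G h e → ∀ du ∈ S.onwardO G h (tgt e), ∀ j < S.Γ.K,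
      ∀ o : Finset (Sym2 V),
      1 - δ₂ < (prodBernoulli (S.Wt G h e (S.aOf₁O G h e) (S.aOf₂O G h e) du j o)).real
        (⋃ b ∈ FD.Face (S.aOf₂O G h e) (tgt e) du (j + 1), openConn S.Γ.root b) →
        S.cond G h e (S.aOf₁O G h e) (S.aOf₂O G h e) du j o) ∧
  (∀ h e, (S.astOf₂O G h).st.ochoice qNE = some e → S.Valid₂O G h e → ∀ du ∈ S.onwardO G h (tgt e),
      1 - ε' < (prodBernoulli (S.Wfull G h e (S.aOf₁O G h e) (S.aOf₂O G h e) du)).real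
        (S.Reach G FD h e (S.aOf₁O G h e) (S.aOf₂O G h e) du))

/-- **Records + constants + `KitAtChosenO` ⟹ `θ_{root}(p) > 0`.** [cite: KozmaNitzan2024, §4 Theorem 6 (pp. 25–31)] -/
theorem theta_pos_of_kitAtChosenO (hΓ : RunGeom G S.Γ) (hA : AnchGeom S.Γ) (hsep : SepGeom₂ G S.Γ) (hX : ExitGeom G S.Γ)
    (hSt : StepsGeom S.Γ FD) (hL : LevelGeom G S.Γ FD LD) (hδc : S.δc ≤ 1) {ε ε' δ₂ : ℝ} (hε : ε ≤ (1 / 2) ^ 32) (hε' : 0 ≤ ε')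
    (hδ₂ : δ₂ ≤ 1) (hKε : 4 * ((1 - δ₂) ^ S.Γ.K + ε') ≤ ε) (hp : 0 < (S.p : ℝ)) (hkit : KitAtChosenO G S FD δ₂ ε') :
    0 < theta G S.Γ.root S.p := by
  obtain ⟨hQ0, hface, hreach⟩ := hkit
  exact theta_pos_of_kit₂_chosen'O hΓ hA hsep hX hSt hL hδc hε hε' hδ₂ hKε hp hQ0 hface hreach

omit [Countable V] in
/-- The all-edges form implies the chosen-edges form (so every landed discharge of the stronger interface still serves). [folklore] -/
theorem kitAtChosen_of_forallO {δ₂ ε' : ℝ}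
    (hQ0 : ∀ du : MDir, du.2 = qNE du.1 → 1 - S.δc < (prodBernoulli (pinW (KNLevels.lattW G S.p) ↑(S.U₀ G) ↑(S.U₀ G))).real
      (⋃ t ∈ (↑(S.Γ.M S.Γ.a₀ ((0 : Site 2) + stepVec du)) : Set V),
        openConnIn (↑(S.Γ.Q S.Γ.a₀ 0 ∪ S.Γ.Ewv S.Γ.a₀ 0 du) : Set V) S.Γ.root t))
    (hface : ∀ h e, S.Valid₂O G h e → ∀ du ∈ S.onwardO G h (tgt e), ∀ j < S.Γ.K, ∀ o : Finset (Sym2 V),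
      1 - δ₂ < (prodBernoulli (S.Wt G h e (S.aOf₁O G h e) (S.aOf₂O G h e) du j o)).real
        (⋃ b ∈ FD.Face (S.aOf₂O G h e) (tgt e) du (j + 1), openConn S.Γ.root b) →
        S.cond G h e (S.aOf₁O G h e) (S.aOf₂O G h e) du j o)
    (hreach : ∀ h e, S.Valid₂O G h e → ∀ du ∈ S.onwardO G h (tgt e),
      1 - ε' < (prodBernoulli (S.Wfull G h e (S.aOf₁O G h e) (S.aOf₂O G h e) du)).real
        (S.Reach G FD h e (S.aOf₁O G h e) (S.aOf₂O G h e) du)) :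
    KitAtChosenO G S FD δ₂ ε' :=
  ⟨hQ0, fun h e _ hV => hface h e hV, fun h e _ hV => hreach h e hV⟩

end KSchA

end KNCells

end Transplant

end Summit.CriticalPhenomena.PercolationContinuityZ3.Theorems

end

/-! ## (merged module) the oriented twin `KNCells2RunRestrictedO` — same port rules, header as in part 1 -/
noncomputable section

open MeasureTheory ProbabilityTheory
open scoped ENNReal Classical

namespace Summit.CriticalPhenomena.PercolationContinuityZ3.Theorems

namespace Transplant

namespace KNCells

open Literature.Probability.Percolation Literature.Probability.LatticeModels SimpleGraph GadgetSystem ProbeHistory HSiteScheme Contour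

namespace KSchA

section Defs

variable {V : Type*} [DecidableEq V] {A : Type*} (G : SimpleGraph V) [G.LocallyFinite] (S : KSchA V A)

/-- **Run histories**: the histories produced by `scheme₂O` on some configuration after some number of steps. [folklore] -/
def IsRun₂O (h : ProbeHistory V) : Prop := ∃ (ω : BondConfig V) (n : ℕ), S.hst₂O G ω n = h

/-- **The run-restricted next probe**: `nextProbe₂O` at run histories, no probe elsewhere. [folklore] -/
def nextProbeRun₂O (h : ProbeHistory V) : Option (AProbe V) :=
  if S.IsRun₂O G h then S.nextProbe₂O G h else none

/-- **The run-restricted exploration process** (same initial edges and success criterion as `scheme₂O`). [cite: KozmaNitzan2024, §4 pp. 26–27] -/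
def schemeRun₂O : HSiteScheme V := ⟨⟨S.nextProbeRun₂O G⟩, S.U₀ G, S.succ₂'O G⟩

variable {G S}

/-- A history of the run is a run history. [folklore] -/
theorem isRun₂_hst₂O (ω : BondConfig V) (n : ℕ) : S.IsRun₂O G (S.hst₂O G ω n) := ⟨ω, n, rfl⟩

/-- At a run history the restricted next probe is `nextProbe₂O`. [folklore] -/
theorem nextProbeRun₂_of_isRunO {h : ProbeHistory V} (hr : S.IsRun₂O G h) : S.nextProbeRun₂O G h = S.nextProbe₂O G h := if_pos hr

/-- If the restricted scheme probes, the history is a run history and `nextProbe₂O` probes. [folklore] -/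
theorem nextProbeRun₂_eq_someO {h : ProbeHistory V} {P : AProbe V} (hP : S.nextProbeRun₂O G h = some P) :
    S.IsRun₂O G h ∧ S.nextProbe₂O G h = some P := by
  by_cases hr : S.IsRun₂O G h
  · exact ⟨hr, by rwa [nextProbeRun₂_of_isRunO hr] at hP⟩
  · rw [nextProbeRun₂O, if_neg hr] at hP; exact absurd hP (by simp)

/-- The explorer of the restricted scheme. [folklore] -/
theorem schemeRun₂_nextO : (S.schemeRun₂O G).E.next = S.nextProbeRun₂O G := rfl

/-- **The restricted scheme has the same runs.** [folklore] -/
theorem hist_schemeRun₂O (ω : BondConfig V) : ∀ n : ℕ, (S.schemeRun₂O G).E.hist n ω = S.hst₂O G ω n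
  | 0 => rfl
  | n + 1 => by
    rw [AExplorer.hist_succ, hist_schemeRun₂O ω n]
    show (S.schemeRun₂O G).E.step (S.hst₂O G ω n) ω :: S.hst₂O G ω n = (S.scheme₂O G).E.hist (n + 1) ω
    rw [AExplorer.hist_succ]
    have hstep : (S.schemeRun₂O G).E.step (S.hst₂O G ω n) ω = (S.scheme₂O G).E.step (S.hst₂O G ω n) ω := by
      show ((S.nextProbeRun₂O G (S.hst₂O G ω n)).map fun P => P.record ω) = ((S.nextProbe₂O G (S.hst₂O G ω n)).map fun P => P.record ω)
      rw [nextProbeRun₂_of_isRunO (isRun₂_hst₂O ω n)]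
    rw [hstep]

/-- Hence the same replayed macro-states … [folklore] -/
theorem stN_schemeRun₂O (n : ℕ) (ω : BondConfig V) : (S.schemeRun₂O G).ostN qNE n ω = (S.scheme₂O G).ostN qNE n ω := by
  show HSiteScheme.omstOf qNE (S.schemeRun₂O G).succ ((S.schemeRun₂O G).E.hist n ω) =
    HSiteScheme.omstOf qNE (S.scheme₂O G).succ ((S.scheme₂O G).E.hist n ω)
  rw [hist_schemeRun₂O]
  rfl

/-- … the same final occupied macro-clusters … [folklore] -/
theorem occFinal_schemeRun₂O (ω : BondConfig V) : (S.schemeRun₂O G).ooccFinal qNE ω = (S.scheme₂O G).ooccFinal qNE ω := by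
  simp only [HSiteScheme.ooccFinal, stN_schemeRun₂O]

/-- … the same initial event … [folklore] -/
theorem initEvent_schemeRun₂O : (S.schemeRun₂O G).initEvent = (S.scheme₂O G).initEvent := rfl

/-- … and the same macro-state replay. [folklore] -/
theorem schemeRun₂_mstO (h : ProbeHistory V) : (S.schemeRun₂O G).omst qNE h = (S.astOf₂O G h).st := S.mst_eq_astOf₂O h

end Defs

section Node

variable {V : Type} [DecidableEq V] [Countable V]
variable {A : Type*} {G : SimpleGraph V} [G.LocallyFinite] {S : KSchA V A} {FD : FaceData V A} {LD : LevelData V A}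

/-- **The run-restricted scheme is lawful from (32) at the root and the failure bound AT RUN HISTORIES, chosen edges only.**
[cite: KozmaNitzan2024, §4 pp. 25–31] -/
theorem lawfulRun₂O (hΓ : RunGeom G S.Γ) (hA : AnchGeom S.Γ) (hsep : SepGeom₂ G S.Γ) {ε : ℝ}
    (hQ0 : ∀ du : MDir, du.2 = qNE du.1 → 1 - S.δc < (prodBernoulli (pinW (KNLevels.lattW G S.p) ↑(S.U₀ G) ↑(S.U₀ G))).real
      (⋃ t ∈ (↑(S.Γ.M S.Γ.a₀ ((0 : Site 2) + stepVec du)) : Set V),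
        openConnIn (↑(S.Γ.Q S.Γ.a₀ 0 ∪ S.Γ.Ewv S.Γ.a₀ 0 du) : Set V) S.Γ.root t))
    (hfail : ∀ h e, S.IsRun₂O G h → (S.astOf₂O G h).st.ochoice qNE = some e → S.Valid₂O G h e →
      (bondPercolation G S.p).real
        {ω | ¬S.succ₂O G h e (S.aOf₁O G h e) (S.aOf₂O G h e) ((S.probe₂O G h e (S.aOf₁O G h e) (S.aOf₂O G h e)).read ω)} ≤ ε) :
    (S.schemeRun₂O G).OLawful qNE G S.p ε where
  fresh := by
    intro h P hP
    obtain ⟨-, hP'⟩ := nextProbeRun₂_eq_someO hP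
    obtain ⟨e, -, -, rfl⟩ := S.nextProbe₂_eq_someO hP'
    constructor
    · rw [Set.disjoint_left]
      intro x hx hxU
      exact (Finset.mem_sdiff.1 (Finset.mem_coe.1 hx)).2 (S.U₀_subset_F _ (Finset.mem_coe.1 hxU))
    · rw [Finset.disjoint_left]
      intro x hx hxs
      exact (Finset.mem_sdiff.1 hx).2 (Finset.mem_union_right _ hxs)
  probes := by
    intro ω _ n hc
    obtain ⟨e, he⟩ := Option.ne_none_iff_exists'.1 hc
    rw [stN_schemeRun₂O] at he
    have hV : S.Valid₂O G (S.hst₂O G ω n) e := valid_of_choice₂O hΓ hA hsep hQ0 he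
    have he' : (S.astOf₂O G (S.hst₂O G ω n)).st.ochoice qNE = some e := by rw [← S.stN_eq₂O]; exact he
    show S.nextProbeRun₂O G ((S.schemeRun₂O G).E.hist n ω) ≠ none
    rw [hist_schemeRun₂O, nextProbeRun₂_of_isRunO (isRun₂_hst₂O ω n), S.nextProbe₂_of_validO he' hV]
    exact Option.some_ne_none _
  fail := by
    intro h P e hP hc
    obtain ⟨hr, hP'⟩ := nextProbeRun₂_eq_someO hP
    obtain ⟨e', hc', hV, rfl⟩ := S.nextProbe₂_eq_someO hP'
    have hc'' : (S.astOf₂O G h).st.ochoice qNE = some e := by rw [← schemeRun₂_mstO]; exact hc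
    have hcc : some e' = some e := hc'.symm.trans hc''
    cases Option.some_injective _ hcc
    exact hfail h _ hr hc'' hV

/-- **The anchored cells scheme forces `θ_{root}(p) > 0` — failure bound at RUN histories, chosen edges, no envelope bound.**
[cite: KozmaNitzan2024, §4 Theorem 6 (pp. 25–31)] -/
theorem theta_pos_of_cellsRun₂O (hΓ : RunGeom G S.Γ) (hA : AnchGeom S.Γ) (hsep : SepGeom₂ G S.Γ) (hX : ExitGeom G S.Γ)
    (hδc : S.δc ≤ 1) {ε : ℝ} (hε : ε ≤ (1 / 2) ^ 32) (hp : 0 < (S.p : ℝ))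
    (hQ0 : ∀ du : MDir, du.2 = qNE du.1 → 1 - S.δc < (prodBernoulli (pinW (KNLevels.lattW G S.p) ↑(S.U₀ G) ↑(S.U₀ G))).real
      (⋃ t ∈ (↑(S.Γ.M S.Γ.a₀ ((0 : Site 2) + stepVec du)) : Set V),
        openConnIn (↑(S.Γ.Q S.Γ.a₀ 0 ∪ S.Γ.Ewv S.Γ.a₀ 0 du) : Set V) S.Γ.root t))
    (hfail : ∀ h e, S.IsRun₂O G h → (S.astOf₂O G h).st.ochoice qNE = some e → S.Valid₂O G h e →
      (bondPercolation G S.p).real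
        {ω | ¬S.succ₂O G h e (S.aOf₁O G h e) (S.aOf₂O G h e) ((S.probe₂O G h e (S.aOf₁O G h e) (S.aOf₂O G h e)).read ω)} ≤ ε) :
    0 < theta G S.Γ.root S.p :=
  SameP.theta_pos_of_olawful (lawfulRun₂O hΓ hA hsep hQ0 hfail) hε
    (fun x hx => (mem_edgesIn_iff.1 (Finset.mem_coe.1 hx)).1) hp
    (by
      rintro ω' ⟨hA', hinf⟩
      have hinf' : ((S.scheme₂O G).ooccFinal qNE ω').Infinite := by
        have h' : ((S.schemeRun₂O G).ooccFinal qNE ω').Infinite := hinf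
        rwa [occFinal_schemeRun₂O] at h'
      exact Or.inl (mem_percolatesAt_of_infinite₂O hΓ hA hX (ω := ω') hδc hA' hinf'))

/-- **THE NODE OVER ANCHORED CELLS, KIT FORM, obligations at RUN histories and chosen edges.**
[cite: KozmaNitzan2024, §4 Theorem 6 (pp. 25–31)] -/
theorem theta_pos_of_kitRun₂O (hΓ : RunGeom G S.Γ) (hA : AnchGeom S.Γ) (hsep : SepGeom₂ G S.Γ) (hX : ExitGeom G S.Γ)
    (hSt : StepsGeom S.Γ FD) (hδc : S.δc ≤ 1) {ε ε' δ₂ : ℝ} (hε : ε ≤ (1 / 2) ^ 32) (hε' : 0 ≤ ε') (hδ₂ : δ₂ ≤ 1)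
    (hKε : 4 * ((1 - δ₂) ^ S.Γ.K + ε') ≤ ε) (hp : 0 < (S.p : ℝ))
    (hQ0 : ∀ du : MDir, du.2 = qNE du.1 → 1 - S.δc < (prodBernoulli (pinW (KNLevels.lattW G S.p) ↑(S.U₀ G) ↑(S.U₀ G))).real
      (⋃ t ∈ (↑(S.Γ.M S.Γ.a₀ ((0 : Site 2) + stepVec du)) : Set V),
        openConnIn (↑(S.Γ.Q S.Γ.a₀ 0 ∪ S.Γ.Ewv S.Γ.a₀ 0 du) : Set V) S.Γ.root t))
    (hP1 : ∀ h e, S.Valid₂O G h e → ∀ du ∈ S.onwardO G h (tgt e), ∀ ω,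
      ω ∈ KNLevels.lattOnly G (S.Vx G h ∪ S.Γ.Ewv (S.aOf₁O G h e) e.1 e.2 ∪ FD.Hfull (S.aOf₂O G h e) (tgt e) du) →
      ω ∈ S.Reach G FD h e (S.aOf₁O G h e) (S.aOf₂O G h e) du → ω ∈ S.Aface G FD h e (S.aOf₁O G h e) (S.aOf₂O G h e) du (S.Γ.K - 1))
    (hP2 : ∀ h e, S.Valid₂O G h e → ∀ du ∈ S.onwardO G h (tgt e), ∀ ω j, 1 ≤ j → j < S.Γ.K →
      ω ∈ KNLevels.lattOnly G (S.Vx G h ∪ S.Γ.Ewv (S.aOf₁O G h e) e.1 e.2 ∪ S.Γ.Stub (S.aOf₂O G h e) (tgt e) du (j + 1)) →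
      ω ∈ S.Aface G FD h e (S.aOf₁O G h e) (S.aOf₂O G h e) du j → ω ∈ S.Aface G FD h e (S.aOf₁O G h e) (S.aOf₂O G h e) du (j - 1))
    (hface : ∀ h e, S.IsRun₂O G h → (S.astOf₂O G h).st.ochoice qNE = some e → S.Valid₂O G h e → ∀ du ∈ S.onwardO G h (tgt e),
      ∀ j < S.Γ.K, ∀ o : Finset (Sym2 V),
      1 - δ₂ < (prodBernoulli (S.Wt G h e (S.aOf₁O G h e) (S.aOf₂O G h e) du j o)).real
        (⋃ b ∈ FD.Face (S.aOf₂O G h e) (tgt e) du (j + 1), openConn S.Γ.root b) →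
        S.cond G h e (S.aOf₁O G h e) (S.aOf₂O G h e) du j o)
    (hreach : ∀ h e, S.IsRun₂O G h → (S.astOf₂O G h).st.ochoice qNE = some e → S.Valid₂O G h e → ∀ du ∈ S.onwardO G h (tgt e),
      1 - ε' < (prodBernoulli (S.Wfull G h e (S.aOf₁O G h e) (S.aOf₂O G h e) du)).real
        (S.Reach G FD h e (S.aOf₁O G h e) (S.aOf₂O G h e) du)) :
    0 < theta G S.Γ.root S.p := by
  refine theta_pos_of_cellsRun₂O hΓ hA hsep hX hδc hε hp hQ0 fun h e hr hc hV => ?_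
  exact (fail_bound₂O hV.anch hV hSt hε' hδ₂ (hP1 h e hV) (hP2 h e hV) (hface h e hr hc hV) (hreach h e hr hc hV)).trans hKε

/-- **THE NODE, kit form with a level geometry, obligations at RUN histories and chosen edges.**
[cite: KozmaNitzan2024, §4 Theorem 6 (pp. 25–31)] -/
theorem theta_pos_of_kitRun₂'O (hΓ : RunGeom G S.Γ) (hA : AnchGeom S.Γ) (hsep : SepGeom₂ G S.Γ) (hX : ExitGeom G S.Γ)
    (hSt : StepsGeom S.Γ FD) (hL : LevelGeom G S.Γ FD LD) (hδc : S.δc ≤ 1) {ε ε' δ₂ : ℝ} (hε : ε ≤ (1 / 2) ^ 32) (hε' : 0 ≤ ε')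
    (hδ₂ : δ₂ ≤ 1) (hKε : 4 * ((1 - δ₂) ^ S.Γ.K + ε') ≤ ε) (hp : 0 < (S.p : ℝ))
    (hQ0 : ∀ du : MDir, du.2 = qNE du.1 → 1 - S.δc < (prodBernoulli (pinW (KNLevels.lattW G S.p) ↑(S.U₀ G) ↑(S.U₀ G))).real
      (⋃ t ∈ (↑(S.Γ.M S.Γ.a₀ ((0 : Site 2) + stepVec du)) : Set V),
        openConnIn (↑(S.Γ.Q S.Γ.a₀ 0 ∪ S.Γ.Ewv S.Γ.a₀ 0 du) : Set V) S.Γ.root t))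
    (hface : ∀ h e, S.IsRun₂O G h → (S.astOf₂O G h).st.ochoice qNE = some e → S.Valid₂O G h e → ∀ du ∈ S.onwardO G h (tgt e),
      ∀ j < S.Γ.K, ∀ o : Finset (Sym2 V),
      1 - δ₂ < (prodBernoulli (S.Wt G h e (S.aOf₁O G h e) (S.aOf₂O G h e) du j o)).real
        (⋃ b ∈ FD.Face (S.aOf₂O G h e) (tgt e) du (j + 1), openConn S.Γ.root b) →
        S.cond G h e (S.aOf₁O G h e) (S.aOf₂O G h e) du j o)
    (hreach : ∀ h e, S.IsRun₂O G h → (S.astOf₂O G h).st.ochoice qNE = some e → S.Valid₂O G h e → ∀ du ∈ S.onwardO G h (tgt e),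
      1 - ε' < (prodBernoulli (S.Wfull G h e (S.aOf₁O G h e) (S.aOf₂O G h e) du)).real
        (S.Reach G FD h e (S.aOf₁O G h e) (S.aOf₂O G h e) du)) :
    0 < theta G S.Γ.root S.p :=
  theta_pos_of_kitRun₂O hΓ hA hsep hX hSt hδc hε hε' hδ₂ hKε hp hQ0 (fun _ _ hV => facePrefix₂_P1O hL hV)
    (fun _ _ hV => facePrefix₂_P2O hL hSt hV) hface hreach

end Node

end KSchA

end KNCells

end Transplant

end Summit.CriticalPhenomena.PercolationContinuityZ3.Theorems

end

/-! ## (merged module) the oriented twin `KNCells2KitAtRunO` — same port rules, header as in part 1 -/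
noncomputable section

open MeasureTheory ProbabilityTheory
open scoped ENNReal Classical

namespace Summit.CriticalPhenomena.PercolationContinuityZ3.Theorems

namespace Transplant

namespace KNCells

open Literature.Probability.Percolation Literature.Probability.LatticeModels SimpleGraph GadgetSystem ProbeHistory HSiteScheme Contour

namespace KSchA

variable {V : Type} [DecidableEq V] [Countable V]
variable {A : Type*} {G : SimpleGraph V} [G.LocallyFinite] {S : KSchA V A} {FD : FaceData V A} {LD : LevelData V A}

/-- **The probabilistic obligations of the node AT RUN HISTORIES AND CHOSEN EDGES**: (32) at the root; for every RUN history whose chosen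
candidate is `e`, valid, and every onward direction, the target lemma at the faces and the corridor bound at the history anchors.
[cite: KozmaNitzan2024, §4 (30), (32), Lemma 10 at the faces, Lemmas 11–12] -/
def KitAtRunO (G : SimpleGraph V) [G.LocallyFinite] (S : KSchA V A) (FD : FaceData V A) (δ₂ ε' : ℝ) : Prop :=
  (∀ du : MDir, du.2 = qNE du.1 → 1 - S.δc < (prodBernoulli (pinW (KNLevels.lattW G S.p) ↑(S.U₀ G) ↑(S.U₀ G))).real
      (⋃ t ∈ (↑(S.Γ.M S.Γ.a₀ ((0 : Site 2) + stepVec du)) : Set V),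
        openConnIn (↑(S.Γ.Q S.Γ.a₀ 0 ∪ S.Γ.Ewv S.Γ.a₀ 0 du) : Set V) S.Γ.root t)) ∧
  (∀ h e, S.IsRun₂O G h → (S.astOf₂O G h).st.ochoice qNE = some e → S.Valid₂O G h e → ∀ du ∈ S.onwardO G h (tgt e), ∀ j < S.Γ.K,
      ∀ o : Finset (Sym2 V),
      1 - δ₂ < (prodBernoulli (S.Wt G h e (S.aOf₁O G h e) (S.aOf₂O G h e) du j o)).real
        (⋃ b ∈ FD.Face (S.aOf₂O G h e) (tgt e) du (j + 1), openConn S.Γ.root b) →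
        S.cond G h e (S.aOf₁O G h e) (S.aOf₂O G h e) du j o) ∧
  (∀ h e, S.IsRun₂O G h → (S.astOf₂O G h).st.ochoice qNE = some e → S.Valid₂O G h e → ∀ du ∈ S.onwardO G h (tgt e),
      1 - ε' < (prodBernoulli (S.Wfull G h e (S.aOf₁O G h e) (S.aOf₂O G h e) du)).real
        (S.Reach G FD h e (S.aOf₁O G h e) (S.aOf₂O G h e) du))

/-- **Records + constants + `KitAtRunO` ⟹ `θ_{root}(p) > 0`.** [cite: KozmaNitzan2024, §4 Theorem 6 (pp. 25–31)] -/
theorem theta_pos_of_kitAtRunO (hΓ : RunGeom G S.Γ) (hA : AnchGeom S.Γ) (hsep : SepGeom₂ G S.Γ) (hX : ExitGeom G S.Γ)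
    (hSt : StepsGeom S.Γ FD) (hL : LevelGeom G S.Γ FD LD) (hδc : S.δc ≤ 1) {ε ε' δ₂ : ℝ} (hε : ε ≤ (1 / 2) ^ 32) (hε' : 0 ≤ ε')
    (hδ₂ : δ₂ ≤ 1) (hKε : 4 * ((1 - δ₂) ^ S.Γ.K + ε') ≤ ε) (hp : 0 < (S.p : ℝ)) (hkit : KitAtRunO G S FD δ₂ ε') :
    0 < theta G S.Γ.root S.p := by
  obtain ⟨hQ0, hface, hreach⟩ := hkit
  exact theta_pos_of_kitRun₂'O hΓ hA hsep hX hSt hL hδc hε hε' hδ₂ hKε hp hQ0 hface hreach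

omit [Countable V] in
/-- The chosen-edges form implies the run form (so every landed discharge of `KitAtChosenO` still serves). [folklore] -/
theorem kitAtRun_of_chosenO {δ₂ ε' : ℝ} (h : KitAtChosenO G S FD δ₂ ε') : KitAtRunO G S FD δ₂ ε' :=
  ⟨h.1, fun h' e _ hc hV => h.2.1 h' e hc hV, fun h' e _ hc hV => h.2.2 h' e hc hV⟩

end KSchA

end KNCells

end Transplant

end Summit.CriticalPhenomena.PercolationContinuityZ3.Theorems

end
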